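import Literature.NumberTheory.LFunctions.MoebiusWalshVaughan
import Literature.NumberTheory.LFunctions.LiouvilleSumClassicalBound
import HarnessLib

/-!
# Liouville–Walsh sums: the combinatorial (Vaughan) reduction to type-I/II dyadic box sums — proved

Topic `Literature/NumberTheory/LFunctions`, proofs companion of `MoebiusWalshCircuits.lean`
(named fact `bourgain_liouville_walsh_uniform`: J. Bourgain, *Möbius–Walsh correlation bounds and
an estimate of Mauduit and Rivat*, J. Anal. Math. 119 (2013) 147–163 = arXiv:1109.2784, Theorem 1
and its parenthesis "(a similar estimate is also valid for the Liouville function)").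
Everything here is PROVED (theorems, plus three elementary `def`s with bodies: the truncation
`liouvilleTrunc` and the two coefficient sequences `liouvTypeICoeff`, `liouvTypeIICoeffB`).
No named fact is introduced.

This is the Liouville twin of `MoebiusWalshVaughan.lean` (the TOP combinatorial layer of the
printed proof: Bourgain, §3, first sentence, "We use Lemma 1 from [M-R] …", i.e. the Vaughan-type
reduction of `∑_{n<X} μ(n) f(n)` to type-I and type-II sums, Mauduit–Rivat, Ann. of Math. 171
(2010), §4 Lemme 1 — printed there for `Λ`, used by Bourgain for `μ`, and asserted for `λ` by the
parenthesis of his Theorem 1 without further comment). For `λ` neither source prints the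
identity; we supply the standard one. With `μ_u`, `λ_u` the truncations to `[1, u]`,
`G_u = (μ − μ_u) * ζ` (`Sieve.Vaughan.gU`, `|G_u| ≤ τ`, `G_u = 0` on `[1, u]`) and Möbius
inversion `μ * ζ = δ`,

  `λ = (λ * ζ) * μ_u + λ_u − (λ_u * μ_u) * ζ + G_u * (λ − λ_u)`      (`liouville_eq_four_terms`)

(expand `G_u * (λ − λ_u) = (λ − λ_u) * (μ * ζ) − (λ − λ_u) * μ_u * ζ` and use `μ * ζ = 1`).
Compared with the three-term identity for `μ` (`Sieve.MoebiusExpSum.moebius_eq_three_terms`,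
`μ = 2μ_u − μ_u * μ_u * ζ + G_u * (μ − μ_u)`) there is ONE new term, `(λ * ζ) * μ_u`, and
`λ * ζ = 𝟙_□` is the indicator of the perfect squares (`LiouvilleSum.zeta_mul_liouville_apply`).
Summed against a test function `|g| ≤ 1` supported on `[1, X]` it is trivially small:
`|∑_{a □ ≤ X} ∑_{b ≤ u} μ(b) g(ab)| ≤ u · #{□ ≤ X} = u ⌊√X⌋` (`abs_squareTerm_le`) — of size
`2^{n/2} u`, negligible against Bourgain's saving `2^{n - n^{1/10}}` for the admissible
`u = 2^{βn}`, `β < 1/2`.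

The rest is as in `MoebiusWalshVaughan.lean`, whose vocabulary is reused verbatim
(`natWalsh`, `dyBlock`, `boxSum`, the cutoff identity `natWalsh_cutoff`/`box_cutoff`, the
divisor-height truncation `truncation_error_le`, and the first type-II coefficient
`typeIICoeffA u B = G_u 𝟙_{τ ≤ B}/B`, which is the same for `μ` and `λ`):

Main statement (`abs_walshSum_liouville_le_boxes`): for all `n`, `u`, `B ≥ 1`, `A ⊆ Fin n`, with
`S = A.map val`, `D_i = [2^i, 2^{i+1})`,

  `|walshSum λ A| ≤ u + u ⌊√(2ⁿ)⌋ + ½ ∑_{T ∈ {S, S ∪ {n}}} ∑_{i+j<n} ( |∑_{a∈D_i} ∑_{b∈D_j} c(a) w_T(ab)|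
      + B |∑_{a∈D_i} ∑_{b∈D_j} α(a) β(b) w_T(ab)| ) + 2ⁿ(n+1)⁴/B`

where `c = λ_u * μ_u` (`|c| ≤ τ`, `c = 0` beyond `u²`: TYPE I, smooth variable `b`),
`α = G_u𝟙_{τ≤B}/B` (`MoebiusWalshVaughan.typeIICoeffA`), `β = λ − λ_u` (`|α|, |β| ≤ 1`, both
vanishing on `[1, u]`: TYPE II). The box sums are the SAME bilinear forms in the Walsh weights as
for `μ` (only the coefficient sequences differ, within the same classes), so the analytic estimates
of Bourgain §2 (type II) and §3 (type I) serve both functions; those estimates and B. Green's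
small-weight bound (`green_liouville_fourierWalsh`) are NOT in this file.

## References

* J. Bourgain, J. Anal. Math. 119 (2013) 147–163, Theorem 1 (Liouville parenthesis), §3 (first
  paragraph), (2.1). [Bourgain2013MoebiusWalsh]
* C. Mauduit, J. Rivat, Ann. of Math. 171 (2010) 1591–1646, §4 Lemme 1 (Vaughan's method, for `Λ`).
* H. Iwaniec, E. Kowalski, *Analytic Number Theory*, Prop. 13.4–13.5 (Vaughan's identity for `μ`);
  `λ = 𝟙_□ ⋆ μ` (Montgomery–Vaughan, §6.2.1 Exercise 11(c)).
-/

noncomputable section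

open Finset Real ArithmeticFunction
open scoped ArithmeticFunction.Moebius ArithmeticFunction.zeta ArithmeticFunction.sigma

namespace Literature.NumberTheory.LFunctions.LiouvilleWalshVaughan

open Literature.NumberTheory.Sieve (moebiusTrunc)
open Literature.NumberTheory.Sieve.Vaughan (gU arith_sub_apply gU_eq_zero_of_le abs_gU_le)
open Literature.NumberTheory.LFunctions.MoebiusWalshVaughan
open Literature.NumberTheory.LFunctions.LiouvilleSum (zeta_mul_liouville_apply
  card_filter_isSquare_Ioc abs_liouville_le_one)

/-! ### The truncated Liouville function and the coefficient sequences -/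

/-- The truncated Liouville function `λ_{≤ u}(n) = λ(n)` if `n ≤ u` and `0` otherwise (the twin
of `Literature.NumberTheory.Sieve.moebiusTrunc`). [folklore] -/
def liouvilleTrunc (u : ℕ) : ArithmeticFunction ℤ :=
  ⟨fun n => if n ≤ u then liouville n else 0, by simp⟩

/-- Unfolding lemma for `liouvilleTrunc`. [folklore] -/
@[simp]
theorem liouvilleTrunc_apply (u n : ℕ) : liouvilleTrunc u n = if n ≤ u then liouville n else 0 :=
  rfl

/-- `|λ_u(a)| ≤ 1` (real form). [folklore] -/
theorem abs_liouvilleTrunc_le_one (u a : ℕ) :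
    |((liouvilleTrunc u : ArithmeticFunction ℝ)) a| ≤ 1 := by
  rw [intCoe_apply, liouvilleTrunc_apply]
  split_ifs
  · exact abs_liouville_le_one a
  · simp

/-- `(λ − λ_u)(ℓ) = λ(ℓ)` for `ℓ > u` and `0` otherwise. [folklore] -/
theorem liouville_sub_trunc_apply (u ℓ : ℕ) :
    ((liouville : ArithmeticFunction ℝ) - (liouvilleTrunc u : ArithmeticFunction ℝ)) ℓ =
      if ℓ ≤ u then 0 else (liouville ℓ : ℝ) := by
  rw [arith_sub_apply, intCoe_apply, intCoe_apply, liouvilleTrunc_apply]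
  split_ifs <;> simp

/-- The TYPE-I coefficient for `λ`: `c = λ_u * μ_u` (`c(a) = ∑_{a₁a₂ = a, a₁, a₂ ≤ u} λ(a₁)μ(a₂)`),
supported on `a ≤ u²`, `|c| ≤ τ`.
[cite: Bourgain2013MoebiusWalsh, §3 (via [M-R] Lemme 1), Theorem 1 (remark on λ)] -/
def liouvTypeICoeff (u : ℕ) : ℕ → ℝ := fun a =>
  ((liouvilleTrunc u : ArithmeticFunction ℝ) * (moebiusTrunc u : ArithmeticFunction ℝ)) a

/-- `|c(a)| ≤ τ(a)`. [folklore] -/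
theorem abs_liouvTypeICoeff_le (u a : ℕ) : |liouvTypeICoeff u a| ≤ (σ 0 a : ℝ) := by
  unfold liouvTypeICoeff
  rw [mul_apply, sigma_zero_apply,
    Literature.NumberTheory.Sieve.Vaughan.card_divisors_eq_sum_antidiagonal]
  refine (abs_sum_le_sum_abs _ _).trans ?_
  refine sum_le_sum fun x _ => ?_
  rw [abs_mul]
  have h1 := abs_liouvilleTrunc_le_one u x.1
  have h2 := Literature.NumberTheory.Sieve.Vaughan.abs_moebiusTrunc_le_one u x.2
  simp only [intCoe_apply] at h1 ⊢
  calc _ ≤ (1 : ℝ) * 1 := mul_le_mul h1 h2 (abs_nonneg _) zero_le_one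
    _ = 1 := one_mul _

/-- `c(a) = 0` for `a > u²`. [folklore] -/
theorem liouvTypeICoeff_eq_zero {u a : ℕ} (h : u * u < a) : liouvTypeICoeff u a = 0 := by
  unfold liouvTypeICoeff
  rw [mul_apply]
  refine sum_eq_zero fun x hx => ?_
  rw [Nat.mem_divisorsAntidiagonal] at hx
  rw [intCoe_apply, intCoe_apply, liouvilleTrunc_apply,
    Literature.NumberTheory.Sieve.moebiusTrunc_apply]
  by_cases h1 : x.1 ≤ u
  · by_cases h2 : x.2 ≤ u
    · exfalso
      have : x.1 * x.2 ≤ u * u := Nat.mul_le_mul h1 h2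
      omega
    · simp [h2]
  · simp [h1]

/-- The second TYPE-II coefficient for `λ`: `β = λ − λ_u` (`β(ℓ) = λ(ℓ) 𝟙_{ℓ > u}`): `|β| ≤ 1`,
`β = 0` on `[1, u]`. [cite: Bourgain2013MoebiusWalsh, §2 (coefficients `β_n`), Theorem 1 (remark on λ)] -/
def liouvTypeIICoeffB (u : ℕ) : ℕ → ℝ := fun ℓ =>
  ((liouville : ArithmeticFunction ℝ) - (liouvilleTrunc u : ArithmeticFunction ℝ)) ℓ

/-- `β(ℓ) = λ(ℓ) 𝟙_{ℓ > u}`. [folklore] -/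
theorem liouvTypeIICoeffB_apply (u ℓ : ℕ) :
    liouvTypeIICoeffB u ℓ = if ℓ ≤ u then 0 else (liouville ℓ : ℝ) :=
  liouville_sub_trunc_apply u ℓ

/-- `|β(ℓ)| ≤ 1`. [folklore] -/
theorem abs_liouvTypeIICoeffB_le (u ℓ : ℕ) : |liouvTypeIICoeffB u ℓ| ≤ 1 := by
  rw [liouvTypeIICoeffB_apply]
  split_ifs
  · simp
  · exact abs_liouville_le_one ℓ

/-- `β(ℓ) = 0` for `ℓ ≤ u`. [folklore] -/
theorem liouvTypeIICoeffB_eq_zero {u ℓ : ℕ} (hℓ : ℓ ≤ u) : liouvTypeIICoeffB u ℓ = 0 := by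
  rw [liouvTypeIICoeffB_apply, if_pos hℓ]

/-! ### The four-term Vaughan identity for `λ` -/

/-- **Vaughan's identity for the Liouville function** (four terms): with `λ_u`, `μ_u` the
truncations to `[1, u]` and `G_u = (μ − μ_u) * ζ`,
`λ = (λ * ζ) * μ_u + λ_u − λ_u * μ_u * ζ + G_u * (λ − λ_u)` (expand and use `μ * ζ = 1`). The
first term, absent for `μ`, carries the indicator of the squares `λ * ζ = 𝟙_□`.
[cite: Bourgain2013MoebiusWalsh, §3 (via [M-R] Lemme 1), Theorem 1 (remark on λ)] -/
theorem liouville_eq_four_terms (u : ℕ) :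
    (liouville : ArithmeticFunction ℝ) =
      (liouville : ArithmeticFunction ℝ) * (ζ : ArithmeticFunction ℝ) *
          (moebiusTrunc u : ArithmeticFunction ℝ) +
        (liouvilleTrunc u : ArithmeticFunction ℝ) -
        (liouvilleTrunc u : ArithmeticFunction ℝ) * (moebiusTrunc u : ArithmeticFunction ℝ) *
          (ζ : ArithmeticFunction ℝ) +
        gU u * ((liouville : ArithmeticFunction ℝ) - (liouvilleTrunc u : ArithmeticFunction ℝ)) := by
  have h : (μ : ArithmeticFunction ℝ) * (ζ : ArithmeticFunction ℝ) = 1 := coe_moebius_mul_coe_zeta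
  rw [gU]
  linear_combination ((liouvilleTrunc u : ArithmeticFunction ℝ) -
    (liouville : ArithmeticFunction ℝ)) * h

/-- **Vaughan's identity for `λ` summed against a test function** supported on `[1, X]`:
`∑_{m≤X} λ(m)g(m) = ∑_{a □, b} μ_u(b) g(ab) + ∑ λ_u g − ∑_{a,b ≤ X} c(a) g(ab) + ∑_{k,ℓ ≤ X} G_u(k) β(ℓ) g(kℓ)`
(`c = λ_u*μ_u`, `β = λ − λ_u`). [cite: Bourgain2013MoebiusWalsh, §3 (via [M-R] Lemme 1), Theorem 1 (remark on λ)] -/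
theorem sum_liouville_mul_eq_vaughan (u X : ℕ) {g : ℕ → ℝ} (hg0 : ∀ m, X < m → g m = 0) :
    ∑ m ∈ Ioc 0 X, (liouville m : ℝ) * g m =
      ∑ a ∈ Ioc 0 X, ∑ b ∈ Ioc 0 X,
          (if IsSquare a then (1 : ℝ) else 0) * (moebiusTrunc u : ArithmeticFunction ℝ) b * g (a * b) +
        ∑ m ∈ Ioc 0 X, (liouvilleTrunc u : ArithmeticFunction ℝ) m * g m -
        ∑ a ∈ Ioc 0 X, ∑ b ∈ Ioc 0 X, liouvTypeICoeff u a * 1 * g (a * b) +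
        ∑ k ∈ Ioc 0 X, ∑ ℓ ∈ Ioc 0 X, gU u k * liouvTypeIICoeffB u ℓ * g (k * ℓ) := by
  have hV := liouville_eq_four_terms u
  have hpt : ∀ m ∈ Ioc 0 X, (liouville m : ℝ) * g m =
      ((liouville : ArithmeticFunction ℝ) * (ζ : ArithmeticFunction ℝ) *
          (moebiusTrunc u : ArithmeticFunction ℝ)) m * g m +
        (liouvilleTrunc u : ArithmeticFunction ℝ) m * g m -
        ((liouvilleTrunc u : ArithmeticFunction ℝ) * (moebiusTrunc u : ArithmeticFunction ℝ) *
          (ζ : ArithmeticFunction ℝ)) m * g m +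
        (gU u * ((liouville : ArithmeticFunction ℝ) -
          (liouvilleTrunc u : ArithmeticFunction ℝ))) m * g m := by
    intro m _
    have h := congrArg (fun F : ArithmeticFunction ℝ => F m) hV
    simp only [ArithmeticFunction.add_apply, arith_sub_apply] at h
    rw [intCoe_apply (f := liouville)] at h
    rw [h]
    ring
  rw [sum_congr rfl hpt, sum_add_distrib, sum_sub_distrib, sum_add_distrib]
  -- the square term
  have hsq : ∑ m ∈ Ioc 0 X, ((liouville : ArithmeticFunction ℝ) * (ζ : ArithmeticFunction ℝ) *
      (moebiusTrunc u : ArithmeticFunction ℝ)) m * g m =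
      ∑ a ∈ Ioc 0 X, ∑ b ∈ Ioc 0 X,
        (if IsSquare a then (1 : ℝ) else 0) * (moebiusTrunc u : ArithmeticFunction ℝ) b * g (a * b) := by
    rw [sum_mul_conv_eq _ _ hg0]
    refine sum_congr rfl fun a ha => sum_congr rfl fun b _ => ?_
    have ha1 : a ≠ 0 := by have := (mem_Ioc.mp ha).1; omega
    rw [mul_comm (liouville : ArithmeticFunction ℝ) (ζ : ArithmeticFunction ℝ),
      zeta_mul_liouville_apply ha1]
  -- the type I term
  have hI : ∑ m ∈ Ioc 0 X, ((liouvilleTrunc u : ArithmeticFunction ℝ) *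
      (moebiusTrunc u : ArithmeticFunction ℝ) * (ζ : ArithmeticFunction ℝ)) m * g m =
      ∑ a ∈ Ioc 0 X, ∑ b ∈ Ioc 0 X, liouvTypeICoeff u a * 1 * g (a * b) := by
    rw [sum_mul_conv_eq _ _ hg0]
    refine sum_congr rfl fun a _ => sum_congr rfl fun b hb => ?_
    have hb1 : b ≠ 0 := by have := (mem_Ioc.mp hb).1; omega
    rw [natCoe_apply, zeta_apply_ne hb1]
    simp [liouvTypeICoeff]
  -- the type II term
  have hII : ∑ m ∈ Ioc 0 X, (gU u * ((liouville : ArithmeticFunction ℝ) -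
      (liouvilleTrunc u : ArithmeticFunction ℝ))) m * g m =
      ∑ k ∈ Ioc 0 X, ∑ ℓ ∈ Ioc 0 X, gU u k * liouvTypeIICoeffB u ℓ * g (k * ℓ) := by
    rw [sum_mul_conv_eq _ _ hg0]
    rfl
  rw [hsq, hI, hII]

/-! ### The two trivially small terms -/

/-- `|∑_{m ≤ N} λ_u(m) g(m)| ≤ u` for `|g| ≤ 1`. [folklore] -/
theorem abs_sum_liouvilleTrunc_mul_le (u N : ℕ) {g : ℕ → ℝ} (hg1 : ∀ m, |g m| ≤ 1) :
    |∑ m ∈ Ioc 0 N, (liouvilleTrunc u : ArithmeticFunction ℝ) m * g m| ≤ u := by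
  refine (abs_sum_le_sum_abs _ _).trans ?_
  calc ∑ m ∈ Ioc 0 N, |(liouvilleTrunc u : ArithmeticFunction ℝ) m * g m|
      ≤ ∑ m ∈ Ioc 0 N, (if m ≤ u then (1 : ℝ) else 0) := by
        refine sum_le_sum fun m _ => ?_
        rw [abs_mul, intCoe_apply, liouvilleTrunc_apply]
        split_ifs with h
        · calc |((liouville m : ℤ) : ℝ)| * |g m| ≤ 1 * 1 :=
                mul_le_mul (abs_liouville_le_one m) (hg1 m) (abs_nonneg _) zero_le_one
            _ = 1 := one_mul _
        · simp
    _ = (((Ioc 0 N).filter (fun m => m ≤ u)).card : ℝ) := by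
        rw [sum_ite, sum_const_zero, add_zero, sum_const, nsmul_eq_mul, mul_one]
    _ ≤ ((Ioc 0 u).card : ℝ) := by
        have hsub : (Ioc 0 N).filter (fun m => m ≤ u) ⊆ Ioc 0 u := by
          intro m hm; simp only [mem_filter, mem_Ioc] at hm ⊢; omega
        exact_mod_cast card_le_card hsub
    _ = u := by simp

/-- **The square term is trivially small**: for `|g| ≤ 1`,
`|∑_{a ≤ X} ∑_{b ≤ X} 𝟙_□(a) μ_u(b) g(ab)| ≤ ⌊√X⌋ · u` (at most `⌊√X⌋` squares `a ≤ X`, and for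
each the inner sum has at most `u` nonzero terms of modulus `≤ 1`).
[cite: Bourgain2013MoebiusWalsh, Theorem 1 (remark on λ)] -/
theorem abs_squareTerm_le (u X : ℕ) {g : ℕ → ℝ} (hg1 : ∀ m, |g m| ≤ 1) :
    |∑ a ∈ Ioc 0 X, ∑ b ∈ Ioc 0 X,
        (if IsSquare a then (1 : ℝ) else 0) * (moebiusTrunc u : ArithmeticFunction ℝ) b * g (a * b)| ≤
      (Nat.sqrt X : ℝ) * u := by
  have hin : ∀ a, |∑ b ∈ Ioc 0 X, (moebiusTrunc u : ArithmeticFunction ℝ) b * g (a * b)| ≤ u :=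
    fun a => abs_sum_moebiusTrunc_mul_le u X (g := fun b => g (a * b)) (fun b => hg1 _)
  calc |∑ a ∈ Ioc 0 X, ∑ b ∈ Ioc 0 X,
        (if IsSquare a then (1 : ℝ) else 0) * (moebiusTrunc u : ArithmeticFunction ℝ) b * g (a * b)|
      ≤ ∑ a ∈ Ioc 0 X, |∑ b ∈ Ioc 0 X,
        (if IsSquare a then (1 : ℝ) else 0) * (moebiusTrunc u : ArithmeticFunction ℝ) b * g (a * b)| :=
        abs_sum_le_sum_abs _ _
    _ = ∑ a ∈ Ioc 0 X, (if IsSquare a then (1 : ℝ) else 0) *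
        |∑ b ∈ Ioc 0 X, (moebiusTrunc u : ArithmeticFunction ℝ) b * g (a * b)| := by
        refine sum_congr rfl fun a _ => ?_
        have hfac : ∑ b ∈ Ioc 0 X, (if IsSquare a then (1 : ℝ) else 0) *
            (moebiusTrunc u : ArithmeticFunction ℝ) b * g (a * b) =
            (if IsSquare a then (1 : ℝ) else 0) *
              ∑ b ∈ Ioc 0 X, (moebiusTrunc u : ArithmeticFunction ℝ) b * g (a * b) := by
          rw [mul_sum]
          refine sum_congr rfl fun b _ => by ring
        rw [hfac, abs_mul, abs_of_nonneg (by split_ifs <;> norm_num)]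
    _ ≤ ∑ a ∈ Ioc 0 X, (if IsSquare a then (1 : ℝ) else 0) * u := by
        refine sum_le_sum fun a _ => ?_
        exact mul_le_mul_of_nonneg_left (hin a) (by split_ifs <;> norm_num)
    _ = (((Ioc 0 X).filter IsSquare).card : ℝ) * u := by
        rw [← sum_mul, sum_boole]
    _ = (Nat.sqrt X : ℝ) * u := by
        rw [card_filter_isSquare_Ioc]

/-! ### Boxing a bilinear form in the cut-off Walsh weight -/

/-- A bilinear form `∑_{a ≤ 2ⁿ} ∑_{b ≤ 2ⁿ} α(a) β(b) g(ab)` in the cut-off Walsh weight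
`g = w_S 𝟙_{[0, 2ⁿ)}`, `n ∉ S`, as half the sum of the dyadic box sums for `w_S` and `w_{S ∪ {n}}`
over the boxes `D_i × D_j`, `i + j < n` (`natWalsh_cutoff`; boxes with `i + j ≥ n` do not meet the
support). [cite: Bourgain2013MoebiusWalsh, §3 (reduction to (2.1), (3.1))] -/
theorem sum_sum_eq_boxSum {S : Finset ℕ} {n : ℕ} (hnS : n ∉ S) (α β : ℕ → ℝ) {g : ℕ → ℝ}
    (hg : ∀ m, g m = if m < 2 ^ n then natWalsh S m else 0) :
    ∑ a ∈ Ioc 0 (2 ^ n), ∑ b ∈ Ioc 0 (2 ^ n), α a * β b * g (a * b) =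
      ∑ i ∈ range n, ∑ j ∈ range (n - i),
        (boxSum S i j α β + boxSum (insert n S) i j α β) / 2 := by
  have hgN : ∀ m, 2 ^ n ≤ m → g m = 0 := fun m hm => by
    rw [hg, if_neg (Nat.not_lt.mpr hm)]
  rw [sum_Ioc_sum_Ioc_eq_sum_dyBlock (fun a b => α a * β b * g (a * b)) n
    (fun b hb => by rw [hgN _ (Nat.le_mul_of_pos_right _ hb), mul_zero])
    (fun a ha => by rw [hgN _ (Nat.le_mul_of_pos_left _ ha), mul_zero])]
  rw [sum_range_sum_range_eq_of_vanish _ n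
    (fun i j hij => box_eq_zero_of_le hgN hij (fun a b => α a * β b))]
  refine sum_congr rfl fun i hi => sum_congr rfl fun j hj => ?_
  have hij : i + j < n := by
    have := mem_range.mp hi; have := mem_range.mp hj; omega
  have hrw : ∀ a b, α a * β b * g (a * b) =
      α a * β b * (if a * b < 2 ^ n then natWalsh S (a * b) else 0) := fun a b => by rw [hg]
  simp_rw [hrw]
  unfold boxSum
  exact box_cutoff hnS hij (fun a b => α a * β b)

/-- `|∑_i ∑_j (x_{ij} + y_{ij})/2| ≤ ½ ∑_i ∑_j (|x_{ij}| + |y_{ij}|)`. [folklore] -/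
theorem abs_sum_sum_half_le (s : Finset ℕ) (t : ℕ → Finset ℕ) (x y : ℕ → ℕ → ℝ) :
    |∑ i ∈ s, ∑ j ∈ t i, (x i j + y i j) / 2| ≤
      (1 / 2) * ∑ i ∈ s, ∑ j ∈ t i, (|x i j| + |y i j|) := by
  rw [mul_sum]
  refine (abs_sum_le_sum_abs _ _).trans (sum_le_sum fun i _ => ?_)
  rw [mul_sum]
  refine (abs_sum_le_sum_abs _ _).trans (sum_le_sum fun j _ => ?_)
  rw [abs_div, abs_two]
  have := abs_add_le (x i j) (y i j)
  linarith

/-- **Cost of the divisor-height truncation of `G_u`** against a coefficient `|β| ≤ 1` and a test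
function `|g| ≤ 1` supported on `[1, 2ⁿ]`:
`|∑_{k,ℓ ≤ 2ⁿ} G_u(k)𝟙_{τ(k) > B} β(ℓ) g(kℓ)| ≤ 2ⁿ (n+1)⁴ / B` (`truncation_error_le`).
[cite: Bourgain2013MoebiusWalsh, §2 (coefficients `|α_m| ≤ 1`)] -/
theorem abs_truncTail_le {n u B : ℕ} (hB : 1 ≤ B) {β g : ℕ → ℝ} (hβ : ∀ ℓ, |β ℓ| ≤ 1)
    (hg1 : ∀ m, |g m| ≤ 1) (hg0 : ∀ m, 2 ^ n < m → g m = 0) :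
    |∑ k ∈ Ioc 0 (2 ^ n), ∑ ℓ ∈ Ioc 0 (2 ^ n),
        (if (σ 0 k : ℝ) ≤ B then 0 else gU u k) * β ℓ * g (k * ℓ)| ≤
      2 ^ n * ((n : ℝ) + 1) ^ 4 / B := by
  have hB0 : (0 : ℝ) < B := by exact_mod_cast hB
  refine (abs_sum_le_sum_abs _ _).trans ?_
  refine (sum_le_sum fun k _ => abs_sum_le_sum_abs _ _).trans ?_
  have hterm : ∀ k ℓ, |(if (σ 0 k : ℝ) ≤ B then 0 else gU u k) * β ℓ * g (k * ℓ)| ≤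
      (if (B : ℝ) < (σ 0 k : ℝ) then (σ 0 k : ℝ) else 0) * |g (k * ℓ)| := by
    intro k ℓ
    rw [abs_mul, abs_mul]
    refine mul_le_mul ?_ le_rfl (abs_nonneg _) ?_
    · split_ifs with h1 h2 h2
      · simp
      · simp
      · calc |gU u k| * |β ℓ| ≤ (σ 0 k : ℝ) * 1 :=
            mul_le_mul (abs_gU_le u k) (hβ ℓ) (abs_nonneg _) (Nat.cast_nonneg _)
          _ = (σ 0 k : ℝ) := mul_one _
      · exact absurd (le_of_not_gt h2) h1
    · split_ifs <;> positivity
  refine (sum_le_sum fun k _ => sum_le_sum fun ℓ _ => hterm k ℓ).trans ?_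
  refine (truncation_error_le hB hg1 hg0).trans ?_
  push_cast
  exact div_le_div_of_nonneg_right (mul_le_mul_of_nonneg_left (one_add_log_two_pow_le n)
    (by positivity)) hB0.le

/-! ### The reduction -/

/-- **The Vaughan reduction of the Liouville–Walsh sum to dyadic box sums** (Bourgain 2013, §3
with [M-R] Lemme 1, made explicit for `λ`; cutoff removed by `natWalsh_cutoff`, type-II
coefficient truncated at divisor height `B`, square term bounded trivially): for all `n, u` and
`B ≥ 1`, with `S = A.map val`,
`|walshSum λ A| ≤ u + ⌊√(2ⁿ)⌋ u + ½ ∑_{i<n} ∑_{j<n-i} (|box_I(S)| + |box_I(S ∪ {n})|)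
  + (B/2) ∑_{i<n} ∑_{j<n-i} (|box_II(S)| + |box_II(S ∪ {n})|) + 2ⁿ (n+1)⁴ / B`,
where `box_I(T) = boxSum T i j (liouvTypeICoeff u) 1` and
`box_II(T) = boxSum T i j (typeIICoeffA u B) (liouvTypeIICoeffB u)`.
[cite: Bourgain2013MoebiusWalsh, §3 (reduction to (2.1), (3.1)), Theorem 1 (remark on λ)] -/
theorem abs_walshSum_liouville_le_boxes (n u B : ℕ) (hB : 1 ≤ B) (A : Finset (Fin n)) :
    |walshSum (fun m => (liouville m : ℤ)) A| ≤
      (u + (Nat.sqrt (2 ^ n) : ℝ) * u) +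
      (1 / 2) * ∑ i ∈ range n, ∑ j ∈ range (n - i),
        (|boxSum (A.map Fin.valEmbedding) i j (liouvTypeICoeff u) (fun _ => 1)| +
          |boxSum (insert n (A.map Fin.valEmbedding)) i j (liouvTypeICoeff u) (fun _ => 1)|) +
      (B / 2) * ∑ i ∈ range n, ∑ j ∈ range (n - i),
        (|boxSum (A.map Fin.valEmbedding) i j (typeIICoeffA u B) (liouvTypeIICoeffB u)| +
          |boxSum (insert n (A.map Fin.valEmbedding)) i j (typeIICoeffA u B) (liouvTypeIICoeffB u)|) +
      2 ^ n * ((n : ℝ) + 1) ^ 4 / B := by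
  set S : Finset ℕ := A.map Fin.valEmbedding with hS
  have hN : 0 < 2 ^ n := Nat.two_pow_pos n
  have hB0 : (0 : ℝ) < B := by exact_mod_cast hB
  have hnS : n ∉ S := by
    rw [hS, mem_map]
    rintro ⟨j, -, hj⟩
    have h1 : (j : ℕ) = n := hj
    have h2 := j.isLt
    omega
  -- the cut-off Walsh weight
  let g : ℕ → ℝ := fun m => if m < 2 ^ n then natWalsh S m else 0
  have hg : ∀ m, g m = if m < 2 ^ n then natWalsh S m else 0 := fun m => rfl
  have hg1 : ∀ m, |g m| ≤ 1 := by
    intro m; rw [hg]; split_ifs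
    · exact abs_natWalsh_le S m
    · simp
  have hgN : ∀ m, 2 ^ n ≤ m → g m = 0 := fun m hm => by
    rw [hg, if_neg (Nat.not_lt.mpr hm)]
  have hg0 : ∀ m, 2 ^ n < m → g m = 0 := fun m hm => hgN m hm.le
  -- Step 1: the Walsh sum as `∑_{m ≤ 2ⁿ} λ(m) g(m)`
  have h1 : walshSum (fun m => (liouville m : ℤ)) A = ∑ m ∈ Ioc 0 (2 ^ n), (liouville m : ℝ) * g m := by
    rw [walshSum_eq_sum_Ico_natWalsh _ (by simp) A,
      sum_Ioc_zero_eq_sum_Ico_one hN (by rw [hgN _ le_rfl, mul_zero])]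
    refine sum_congr rfl fun m hm => ?_
    rw [hg, if_pos (mem_Ico.mp hm).2]
  -- Step 2: Vaughan
  rw [h1, sum_liouville_mul_eq_vaughan u (2 ^ n) hg0]
  -- Step 3: boxes for the type I term
  have hboxI : ∑ a ∈ Ioc 0 (2 ^ n), ∑ b ∈ Ioc 0 (2 ^ n), liouvTypeICoeff u a * 1 * g (a * b) =
      ∑ i ∈ range n, ∑ j ∈ range (n - i),
        (boxSum S i j (liouvTypeICoeff u) (fun _ => 1) +
          boxSum (insert n S) i j (liouvTypeICoeff u) (fun _ => 1)) / 2 :=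
    sum_sum_eq_boxSum hnS (liouvTypeICoeff u) (fun _ => 1) hg
  -- Step 4: split the type II coefficient and box the bounded part
  have hsplit : ∀ k, gU u k = B * typeIICoeffA u B k +
      (if (σ 0 k : ℝ) ≤ B then 0 else gU u k) := by
    intro k
    unfold typeIICoeffA
    split_ifs with h
    · rw [mul_div_cancel₀ _ hB0.ne', add_zero]
    · ring
  have hII : ∑ k ∈ Ioc 0 (2 ^ n), ∑ ℓ ∈ Ioc 0 (2 ^ n), gU u k * liouvTypeIICoeffB u ℓ * g (k * ℓ) =
      B * ∑ k ∈ Ioc 0 (2 ^ n), ∑ ℓ ∈ Ioc 0 (2 ^ n),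
          typeIICoeffA u B k * liouvTypeIICoeffB u ℓ * g (k * ℓ) +
        ∑ k ∈ Ioc 0 (2 ^ n), ∑ ℓ ∈ Ioc 0 (2 ^ n),
          (if (σ 0 k : ℝ) ≤ B then 0 else gU u k) * liouvTypeIICoeffB u ℓ * g (k * ℓ) := by
    rw [mul_sum, ← sum_add_distrib]
    refine sum_congr rfl fun k _ => ?_
    rw [mul_sum, ← sum_add_distrib]
    refine sum_congr rfl fun ℓ _ => ?_
    conv_lhs => rw [hsplit k]
    ring
  have hboxII : ∑ k ∈ Ioc 0 (2 ^ n), ∑ ℓ ∈ Ioc 0 (2 ^ n),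
      typeIICoeffA u B k * liouvTypeIICoeffB u ℓ * g (k * ℓ) =
      ∑ i ∈ range n, ∑ j ∈ range (n - i),
        (boxSum S i j (typeIICoeffA u B) (liouvTypeIICoeffB u) +
          boxSum (insert n S) i j (typeIICoeffA u B) (liouvTypeIICoeffB u)) / 2 :=
    sum_sum_eq_boxSum hnS (typeIICoeffA u B) (liouvTypeIICoeffB u) hg
  -- Step 5: the small terms
  have hT0 := abs_squareTerm_le u (2 ^ n) hg1
  have hT1 := abs_sum_liouvilleTrunc_mul_le u (2 ^ n) hg1
  have herr := abs_truncTail_le (u := u) hB (abs_liouvTypeIICoeffB_le u) hg1 hg0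
  -- Step 6: assemble
  rw [hboxI, hII, hboxII]
  set T0 := ∑ a ∈ Ioc 0 (2 ^ n), ∑ b ∈ Ioc 0 (2 ^ n),
    (if IsSquare a then (1 : ℝ) else 0) * (moebiusTrunc u : ArithmeticFunction ℝ) b * g (a * b) with hT0def
  set T1 := ∑ m ∈ Ioc 0 (2 ^ n), (liouvilleTrunc u : ArithmeticFunction ℝ) m * g m with hT1def
  set E := ∑ k ∈ Ioc 0 (2 ^ n), ∑ ℓ ∈ Ioc 0 (2 ^ n),
    (if (σ 0 k : ℝ) ≤ B then 0 else gU u k) * liouvTypeIICoeffB u ℓ * g (k * ℓ) with hEdef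
  set XI := ∑ i ∈ range n, ∑ j ∈ range (n - i),
    (boxSum S i j (liouvTypeICoeff u) (fun _ => 1) +
      boxSum (insert n S) i j (liouvTypeICoeff u) (fun _ => 1)) / 2 with hXI
  set XII := ∑ i ∈ range n, ∑ j ∈ range (n - i),
    (boxSum S i j (typeIICoeffA u B) (liouvTypeIICoeffB u) +
      boxSum (insert n S) i j (typeIICoeffA u B) (liouvTypeIICoeffB u)) / 2 with hXII
  set BI := ∑ i ∈ range n, ∑ j ∈ range (n - i),
    (|boxSum S i j (liouvTypeICoeff u) (fun _ => 1)| +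
      |boxSum (insert n S) i j (liouvTypeICoeff u) (fun _ => 1)|) with hBI
  set BII := ∑ i ∈ range n, ∑ j ∈ range (n - i),
    (|boxSum S i j (typeIICoeffA u B) (liouvTypeIICoeffB u)| +
      |boxSum (insert n S) i j (typeIICoeffA u B) (liouvTypeIICoeffB u)|) with hBII
  have hI' : |XI| ≤ (1 / 2) * BI := abs_sum_sum_half_le _ _ _ _
  have hII' : |XII| ≤ (1 / 2) * BII := abs_sum_sum_half_le _ _ _ _
  have hBmul : |(B : ℝ) * XII| ≤ (B / 2) * BII := by
    rw [abs_mul, abs_of_pos hB0]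
    calc (B : ℝ) * |XII| ≤ B * ((1 / 2) * BII) := mul_le_mul_of_nonneg_left hII' hB0.le
      _ = B / 2 * BII := by ring
  calc |T0 + T1 - XI + ((B : ℝ) * XII + E)|
      ≤ |T0| + |T1| + |XI| + (|(B : ℝ) * XII| + |E|) := by
        refine (abs_add_le _ _).trans (add_le_add ?_ (abs_add_le _ _))
        exact (abs_sub _ _).trans (add_le_add (abs_add_le _ _) le_rfl)
    _ ≤ (Nat.sqrt (2 ^ n) : ℝ) * u + u + (1 / 2) * BI +
          ((B / 2) * BII + 2 ^ n * ((n : ℝ) + 1) ^ 4 / B) := by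
        refine add_le_add (add_le_add (add_le_add ?_ hT1) hI') (add_le_add hBmul herr)
        exact_mod_cast hT0
    _ = (u + (Nat.sqrt (2 ^ n) : ℝ) * u) + (1 / 2) * BI + (B / 2) * BII +
          2 ^ n * ((n : ℝ) + 1) ^ 4 / B := by ring

end Literature.NumberTheory.LFunctions.LiouvilleWalshVaughan
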